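/-
Copyright (c) 2026. All rights reserved.
Released under Apache 2.0 license as described in the file LICENSE.
-/
import Mathlib
import HarnessLib
import Literature.MathematicalPhysics.QuantumLattice.AbelianFieldTensor
import Literature.MathematicalPhysics.QuantumLattice.AbelianMagneticFlux
import Literature.MathematicalPhysics.QuantumFieldTheory.U1WardIdentity
import Summits.Ventures.LatticeQCDFlow.Scaling.FluxSectorCollar
import Summits.Ventures.LatticeQCDFlow.Scaling.SliceTwistWitness
import Summits.Ventures.LatticeQCDFlow.Scaling.FluxInsertionKernel
import Summits.Ventures.LatticeQCDFlow.Scaling.FluxInsertionLine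
import Summits.Ventures.LatticeQCDFlow.Scaling.FluxInsertionSharpFloorInstances
import Summits.Ventures.LatticeQCDFlow.Scaling.FluxInsertionHeightLaw
import Summits.Ventures.LatticeQCDFlow.Scaling.TorusPotential
import Summits.Ventures.LatticeQCDFlow.Scaling.FluxInsertionHeightCeiling
import Summits.Ventures.LatticeQCDFlow.Scaling.SectorActionFloor
import Summits.Ventures.LatticeQCDFlow.Scaling.FluxInsertionMountainPass
import Summits.Ventures.LatticeQCDFlow.Scaling.FluxInsertionHeightValue

/-!
# The fixed-volume sharp rate of the LINE flux-insertion kernel EXISTS and EQUALS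
`L(1 − cos(π/L)) + (L² − L)(1 − cos(π/(L² − L)))` (lean-1 GEN-6, own work)

HONEST FRAMING: exact (Metropolis-corrected) sampling algorithms for lattice gauge theory;
figures of merit are autocorrelation/cost numbers at stated couplings and volumes; no
continuum-physics claim.

Venture `LatticeQCDFlow` (cell pub-lqcd), topic `Scaling`, FANOUT row 30 (lean-1).  NEW WORK of the
cell; nothing here is cited as a fact.  `d = 2`, compact `U(1)`, torus `(ℤ/L)²`, gen-19's two-sided
Metropolis LINE-insertion kernel `K_line = insertionMH (sliceTwist L) e^{−βS}` (item 99; the slice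
twist multiplies the `L` plaquettes of the wrapping line `{x₀ = 0}` by `e^{−2πi/L}`), its
essential min–max height `H_line(L) = insHeight₂ (sliceTwist L) 0 0 1` (item 106b), and
`E*_line(L) = L(1 − cos(π/L)) + (L² − L)(1 − cos(π/(L² − L)))`.

Since a wrapping line never covers more than half the torus (`2L ≤ L²`), the generic mountain pass
of `FluxInsertionMountainPass` applies at every volume `L ≥ 5`:
* `lineSharpValue_le_max_wilsonAction`: for EVERY `U` with `Q((sliceTwist L)⁻¹ U) ≠ Q(U)`,
  `max(S(U), S((sliceTwist L)⁻¹ U)) ≥ E*_line(L)`;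
* `lineHeight_le_sharp_ennreal`: the line's half-way configuration `potField(−π/L on the line,
  π/(L² − L) off it)` (item 107a's torus potential) crosses the sector boundary at action
  `E*_line(L)` on both sides, so `H_line(L) ≤ E*_line(L)`;
* `lineHeight_eq_sharp`: **`H_line(L) = E*_line(L)`** for every `L ≥ 5` (every parity);
  `lineHeight_le_pi_sq_div`: `H_line(L) ≤ π²/L`;
* `u1_lineInsertion_fixedVolume_rate`: for every `ε > 0`, eventually in `β`,
  `e^{−β(E*_line + ε)} ≤ (μ_β ⊗ K_line){Q ≠ Q'} ≤ e^{−β(E*_line − ε)}` — the fixed-volume sharp rate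
  of the line kernel EXISTS and EQUALS `E*_line(L)` (item 106b typed the law only for the block).
No `def`.
-/

noncomputable section

open MeasureTheory ProbabilityTheory Filter Topology Real Set
open scoped ENNReal
open Literature.MathematicalPhysics.QuantumFieldTheory Literature.MathematicalPhysics.QuantumLattice
open Summit.Ventures.LatticeQCDFlow.Exactness

namespace Summit.Ventures.LatticeQCDFlow.Theory2.Lattice.Flux

variable {L : ℕ} [NeZero L]

/-! ## §1 The inverse slice twist as a generic insertion -/

section LineInsertion

/-- Membership in the wrapping line through the coordinate representative. [folklore] -/
theorem mem_lineSites_iff_val {x : Site 2 L} : x ∈ lineSites L ↔ (x 0).val = 0 := by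
  rw [mem_lineSites, ZMod.val_eq_zero]

/-- The plaquettes of `(sliceTwist L)⁻¹`: `e^{2πi/L}` on the wrapping line, `1` elsewhere. [folklore] -/
theorem plaquetteHolonomy_sliceTwist_inv_ite (x : Site 2 L) :
    plaquetteHolonomy (sliceTwist L)⁻¹ x 0 1 =
      Circle.exp (if x ∈ lineSites L then 2 * π / L else 0) := by
  rw [plaquetteHolonomy_inv, plaquetteHolonomy_sliceTwist]
  by_cases h : x 0 = 0
  · rw [if_pos h, if_pos (mem_lineSites.mpr h), inv_inv, toCircle_one_eq_exp]
  · rw [if_neg h, if_neg (fun h' => h (mem_lineSites.mp h')), inv_one, Circle.exp_zero]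

/-- The same plaquettes through the coordinate table `a ↦ [a = 0]·2π/L`. [folklore] -/
theorem plaquetteHolonomy_sliceTwist_inv_val (x : Site 2 L) :
    plaquetteHolonomy (sliceTwist L)⁻¹ x 0 1 =
      Circle.exp (if (x 0).val = 0 then 2 * π / L else 0) := by
  rw [plaquetteHolonomy_sliceTwist_inv_ite]
  simp only [mem_lineSites_iff_val]

/-- `#(lineSites L)ᶜ = L² − L`. [folklore] -/
theorem card_compl_lineSites : (((lineSites L)ᶜ.card : ℕ) : ℝ) = (L : ℝ) ^ 2 - L := by
  rw [Finset.card_compl, card_site_two, card_lineSites, Nat.cast_sub (by nlinarith : L ≤ L ^ 2)]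
  push_cast
  ring

/-- **THE MOUNTAIN-PASS INEQUALITY FOR THE LINE** (`5 ≤ L`): for EVERY configuration `U` whose
charge is changed by the inverse slice twist, `max(S(U), S((sliceTwist L)⁻¹ U)) ≥
L(1 − cos(π/L)) + (L² − L)(1 − cos(π/(L² − L)))`. [folklore] -/
theorem lineSharpValue_le_max_wilsonAction (hL : 5 ≤ L) (U : GaugeConfig 2 L Circle)
    (hne : topCharge (0 : Site 2 L) 0 1 ((sliceTwist L)⁻¹ * U) ≠ topCharge (0 : Site 2 L) 0 1 U) :
    (L : ℝ) * (1 - Real.cos (π / L)) +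
        ((L : ℝ) ^ 2 - L) * (1 - Real.cos (π / ((L : ℝ) ^ 2 - L))) ≤
      max (wilsonAction u1Rep U) (wilsonAction u1Rep ((sliceTwist L)⁻¹ * U)) := by
  have hL' : (5 : ℝ) ≤ L := by exact_mod_cast hL
  have hcard : ((lineSites L).card : ℝ) = L := by rw [card_lineSites]
  have hN5 : 5 ≤ (lineSites L).card := by rw [card_lineSites]; exact hL
  have hNM : (lineSites L).card ≤ (lineSites L)ᶜ.card := by
    have : ((lineSites L).card : ℝ) ≤ (((lineSites L)ᶜ.card : ℕ) : ℝ) := by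
      rw [hcard, card_compl_lineSites]; nlinarith
    exact_mod_cast this
  have hNα : ((lineSites L).card : ℝ) * (2 * π / L) = 2 * π := by
    rw [hcard]; field_simp
  have h := sharpValue_le_max_wilsonAction_of_exp (sliceTwist L)⁻¹ U (lineSites L)
    (plaquetteHolonomy_sliceTwist_inv_ite) (by positivity) hNα hN5 hNM hne
  rw [hcard, card_compl_lineSites, show 2 * π / (L : ℝ) / 2 = π / L by ring] at h
  exact h

end LineInsertion

/-! ## §2 The half-way configuration of the line insertion (the ceiling) -/

section LineWitness

/-- Column sums of a table that depends only on `[a = 0]`: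
`Σ_{a,b<L} [a=0]·u + [a≠0]·v = L·u + (L² − L)·v`. [folklore] -/
theorem sum_lineTable (hL : 1 ≤ L) (u v : ℝ) :
    ∑ a ∈ Finset.range L, ∑ _b ∈ Finset.range L, (if a = 0 then u else v) =
      (L : ℝ) * u + ((L : ℝ) ^ 2 - L) * v := by
  obtain ⟨n, rfl⟩ : ∃ n, L = n + 1 := ⟨L - 1, by omega⟩
  simp only [Finset.sum_const, Finset.card_range, nsmul_eq_mul]
  rw [Finset.sum_range_succ']
  simp only [Nat.succ_ne_zero, if_false, if_true, Finset.sum_const, Finset.card_range,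
    nsmul_eq_mul]
  push_cast
  ring

/-- The half-way table of the line has total zero: `L·(−π/L) + (L² − L)·π/(L² − L) = 0`
(`2 ≤ L`). [folklore] -/
theorem sum_lineHalfTable (hL : 2 ≤ L) :
    ∑ a ∈ Finset.range L, ∑ _b ∈ Finset.range L,
      (if a = 0 then -(π / L) else π / ((L : ℝ) ^ 2 - L)) = 0 := by
  have hL' : (2 : ℝ) ≤ L := by exact_mod_cast hL
  have hL0 : (L : ℝ) ≠ 0 := by positivity
  have hM0 : (L : ℝ) ^ 2 - L ≠ 0 := by nlinarith
  have e1 : (L : ℝ) * (π / L) = π := by field_simp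
  have e2 : ((L : ℝ) ^ 2 - L) * (π / ((L : ℝ) ^ 2 - L)) = π := mul_div_cancel₀ _ hM0
  rw [sum_lineTable (by omega), mul_neg, e1, e2]
  ring

omit [NeZero L] in
/-- After the insertion the table is `π/L` on the line, `π/(L² − L)` off it. [folklore] -/
theorem lineHalfTable_add (a : ℕ) :
    (if a = 0 then 2 * π / (L : ℝ) else 0) + (if a = 0 then -(π / L) else π / ((L : ℝ) ^ 2 - L)) =
      (if a = 0 then π / (L : ℝ) else π / ((L : ℝ) ^ 2 - L)) := by
  split_ifs <;> ring

omit [NeZero L] in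
/-- Bounds: all half-way angles, before and after the insertion, lie in `[−π/5, π/5]` (`5 ≤ L`).
[folklore] -/
theorem lineHalfTable_bounds (hL : 5 ≤ L) (a : ℕ) :
    |(if a = 0 then -(π / L) else π / ((L : ℝ) ^ 2 - L))| ≤ π / 5 ∧
      |(if a = 0 then π / (L : ℝ) else π / ((L : ℝ) ^ 2 - L))| ≤ π / 5 := by
  have hL' : (5 : ℝ) ≤ L := by exact_mod_cast hL
  have h1 : π / (L : ℝ) ≤ π / 5 := div_le_div_of_nonneg_left Real.pi_pos.le (by norm_num) hL'
  have h2 : π / ((L : ℝ) ^ 2 - L) ≤ π / 5 :=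
    div_le_div_of_nonneg_left Real.pi_pos.le (by norm_num) (by nlinarith)
  have h1' : 0 ≤ π / (L : ℝ) := by positivity
  have h2' : 0 ≤ π / ((L : ℝ) ^ 2 - L) := div_nonneg Real.pi_pos.le (by nlinarith)
  constructor <;> split_ifs <;> rw [abs_le] <;> constructor <;> linarith

/-- **THE CEILING FOR THE LINE**: `insHeight (sliceTwist L)⁻¹ ≤ E*_line(L)` (`5 ≤ L`), witnessed by
the half-way configuration `potField(−π/L on the line, π/(L² − L) off it)`. [folklore] -/
theorem lineHeight_le_sharp_ennreal (hL : 5 ≤ L) :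
    insHeight₂ (sliceTwist L) (0 : Site 2 L) 0 1 ≤ ENNReal.ofReal
      ((L : ℝ) * (1 - Real.cos (π / L)) +
        ((L : ℝ) ^ 2 - L) * (1 - Real.cos (π / ((L : ℝ) ^ 2 - L)))) := by
  have hL1 : 1 < L := by omega
  set c : ℕ → ℕ → ℝ := fun a _ => if a = 0 then -(π / L) else π / ((L : ℝ) ^ 2 - L) with hc_def
  have hcs : ∑ a ∈ Finset.range L, ∑ b ∈ Finset.range L, c a b = 0 := by
    simp only [hc_def]; exact sum_lineHalfTable (by omega)
  set U₀ : GaugeConfig 2 L Circle := potField c with hU₀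
  have hP : ∀ x : Site 2 L, plaquetteHolonomy U₀ x 0 1 = Circle.exp (c (x 0).val (x 1).val) :=
    plaquetteHolonomy_potField hL1 hcs
  set c' : ℕ → ℕ → ℝ := fun a _ => if a = 0 then π / (L : ℝ) else π / ((L : ℝ) ^ 2 - L)
    with hc'_def
  have hPX : ∀ x : Site 2 L, plaquetteHolonomy ((sliceTwist L)⁻¹ * U₀) x 0 1 =
      Circle.exp (c' (x 0).val (x 1).val) := by
    intro x
    rw [plaquetteHolonomy_mul', plaquetteHolonomy_sliceTwist_inv_val, hP, ← Circle.exp_add]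
    simp only [hc_def, hc'_def, lineHalfTable_add]
  have hb : ∀ a b, |c a b| ≤ π / 5 ∧ |c' a b| ≤ π / 5 := fun a b => lineHalfTable_bounds hL a
  have hin : ∀ {t : ℝ}, |t| ≤ π / 5 → -π < t ∧ t < π := fun ht => by
    have := abs_le.mp ht; constructor <;> linarith [Real.pi_pos]
  have hFU : ∀ x : Site 2 L, abelianFieldTensor U₀ x 0 1 = c (x 0).val (x 1).val := fun x =>
    abelianFieldTensor_eq_of_plaquette_eq_exp (hP x) (hin (hb (x 0).val (x 1).val).1).1
      (hin (hb (x 0).val (x 1).val).1).2.le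
  have hFX : ∀ x : Site 2 L, abelianFieldTensor ((sliceTwist L)⁻¹ * U₀) x 0 1 =
      c' (x 0).val (x 1).val := fun x =>
    abelianFieldTensor_eq_of_plaquette_eq_exp (hPX x) (hin (hb (x 0).val (x 1).val).2).1
      (hin (hb (x 0).val (x 1).val).2).2.le
  have hL' : (5 : ℝ) ≤ L := by exact_mod_cast hL
  have hL0 : (L : ℝ) ≠ 0 := by positivity
  have hM0 : (L : ℝ) ^ 2 - L ≠ 0 := by nlinarith
  have hcs' : ∑ a ∈ Finset.range L, ∑ b ∈ Finset.range L, c' a b = 2 * π := by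
    simp only [hc'_def]
    have e1 : (L : ℝ) * (π / L) = π := by field_simp
    have e2 : ((L : ℝ) ^ 2 - L) * (π / ((L : ℝ) ^ 2 - L)) = π := mul_div_cancel₀ _ hM0
    rw [sum_lineTable (by omega), e1, e2]
    ring
  have hQU : topCharge (0 : Site 2 L) 0 1 U₀ = 0 := by
    rw [topCharge_of_fieldTensor hFU, hcs, zero_div]
  have hQX : topCharge (0 : Site 2 L) 0 1 ((sliceTwist L)⁻¹ * U₀) = 1 := by
    rw [topCharge_of_fieldTensor hFX, hcs']
    field_simp
  have hval : ∀ (g : ℕ → ℕ → ℝ), (∀ a b, g a b = if a = 0 then π / (L : ℝ) else π / ((L : ℝ) ^ 2 - L)) ∨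
      (∀ a b, g a b = if a = 0 then -(π / (L : ℝ)) else π / ((L : ℝ) ^ 2 - L)) →
      ∑ a ∈ Finset.range L, ∑ b ∈ Finset.range L, (1 - Real.cos (g a b)) =
        (L : ℝ) * (1 - Real.cos (π / L)) +
          ((L : ℝ) ^ 2 - L) * (1 - Real.cos (π / ((L : ℝ) ^ 2 - L))) := by
    intro g hg
    have e : ∀ a b, 1 - Real.cos (g a b) =
        if a = 0 then 1 - Real.cos (π / L) else 1 - Real.cos (π / ((L : ℝ) ^ 2 - L)) := by
      intro a b
      rcases hg with hg | hg <;> rw [hg] <;> split_ifs <;> simp [Real.cos_neg]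
    simp only [e]
    exact sum_lineTable (by omega) _ _
  have hSU : wilsonAction u1Rep U₀ = (L : ℝ) * (1 - Real.cos (π / L)) +
      ((L : ℝ) ^ 2 - L) * (1 - Real.cos (π / ((L : ℝ) ^ 2 - L))) := by
    rw [wilsonAction_of_plaquette_exp hP]
    exact hval c (Or.inr fun a b => rfl)
  have hSX : wilsonAction u1Rep ((sliceTwist L)⁻¹ * U₀) = (L : ℝ) * (1 - Real.cos (π / L)) +
      ((L : ℝ) ^ 2 - L) * (1 - Real.cos (π / ((L : ℝ) ^ 2 - L))) := by
    rw [wilsonAction_of_plaquette_exp hPX]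
    exact hval c' (Or.inl fun a b => rfl)
  have h1 := insHeight_le_of_witness (sliceTwist L)⁻¹ U₀ (0 : Site 2 L) 0 1
    (fun x => by
      rw [hP]
      exact coe_circleExp_mem_slitPlane (hin (hb (x 0).val (x 1).val).1).1
        (hin (hb (x 0).val (x 1).val).1).2)
    (fun x => by
      rw [hPX]
      exact coe_circleExp_mem_slitPlane (hin (hb (x 0).val (x 1).val).2).1
        (hin (hb (x 0).val (x 1).val).2).2)
    (by rw [hQX, hQU]; exact one_ne_zero)
  rw [hSU, hSX, max_self] at h1
  exact (min_le_right _ _).trans h1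

end LineWitness

/-! ## §3 The value of the line height and the fixed-volume sharp rate -/

section LineValue

omit [NeZero L] in
/-- The conjectured value for the line is non-negative. [folklore] -/
theorem lineSharpValue_nonneg (hL : 5 ≤ L) :
    0 ≤ (L : ℝ) * (1 - Real.cos (π / L)) +
        ((L : ℝ) ^ 2 - L) * (1 - Real.cos (π / ((L : ℝ) ^ 2 - L))) := by
  have hL' : (5 : ℝ) ≤ L := by exact_mod_cast hL
  exact add_nonneg (mul_nonneg (by linarith) (sub_nonneg.mpr (Real.cos_le_one _)))
    (mul_nonneg (by nlinarith) (sub_nonneg.mpr (Real.cos_le_one _)))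

/-- **The line height is finite** (`5 ≤ L`). [folklore] -/
theorem lineHeight_ne_top (hL : 5 ≤ L) : insHeight₂ (sliceTwist L) (0 : Site 2 L) 0 1 ≠ ⊤ :=
  ne_top_of_le_ne_top ENNReal.ofReal_ne_top (lineHeight_le_sharp_ennreal hL)

/-- The two-sided height is symmetric under `W ↦ W⁻¹`. [folklore] -/
theorem insHeight₂_inv {d : ℕ} (W : GaugeConfig d L Circle) (x₀ : Site d L) (μ' ν' : Fin d) :
    insHeight₂ W⁻¹ x₀ μ' ν' = insHeight₂ W x₀ μ' ν' := by
  unfold insHeight₂; rw [inv_inv, min_comm]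

/-- **THE FLOOR FOR THE LINE**: `E*_line(L) ≤ H_line(L)` (`5 ≤ L`, every parity). [folklore] -/
theorem lineHeight_ge_sharp (hL : 5 ≤ L) :
    (L : ℝ) * (1 - Real.cos (π / L)) +
        ((L : ℝ) ^ 2 - L) * (1 - Real.cos (π / ((L : ℝ) ^ 2 - L))) ≤
      (insHeight₂ (sliceTwist L) (0 : Site 2 L) 0 1).toReal := by
  refine (ENNReal.ofReal_le_iff_le_toReal (lineHeight_ne_top hL)).mp ?_
  rw [← insHeight₂_inv]
  exact le_insHeight₂_of_forall _ _ _ _ fun U hU => lineSharpValue_le_max_wilsonAction hL U hU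

/-- **THE VALUE OF THE LINE HEIGHT**: `H_line(L) = L(1 − cos(π/L)) + (L² − L)(1 − cos(π/(L² − L)))`
for every `L ≥ 5`. [folklore] -/
theorem lineHeight_eq_sharp (hL : 5 ≤ L) :
    (insHeight₂ (sliceTwist L) (0 : Site 2 L) 0 1).toReal =
      (L : ℝ) * (1 - Real.cos (π / L)) +
        ((L : ℝ) ^ 2 - L) * (1 - Real.cos (π / ((L : ℝ) ^ 2 - L))) :=
  le_antisymm (ENNReal.toReal_le_of_le_ofReal (lineSharpValue_nonneg hL)
    (lineHeight_le_sharp_ennreal hL)) (lineHeight_ge_sharp hL)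

/-- **The line height is `O(1/L)`**: `H_line(L) ≤ π²/L` (`5 ≤ L`), from `1 − cos x ≤ x²/2` and
`L² − L ≥ L`: at fixed `β` the wrapping-line insertion becomes free as `L → ∞`. [folklore] -/
theorem lineHeight_le_pi_sq_div (hL : 5 ≤ L) :
    (insHeight₂ (sliceTwist L) (0 : Site 2 L) 0 1).toReal ≤ π ^ 2 / L := by
  rw [lineHeight_eq_sharp hL]
  have hL' : (5 : ℝ) ≤ L := by exact_mod_cast hL
  set m : ℝ := (L : ℝ) ^ 2 - L with hm
  have hmL : (L : ℝ) ≤ m := by rw [hm]; nlinarith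
  have hm0 : 0 < m := by linarith
  have h1 : (L : ℝ) * (1 - Real.cos (π / L)) ≤ π ^ 2 / (2 * L) := by
    have hc : 1 - (π / L) ^ 2 / 2 ≤ Real.cos (π / L) := Real.one_sub_sq_div_two_le_cos
    have e : (L : ℝ) * ((π / L) ^ 2 / 2) = π ^ 2 / (2 * L) := by field_simp
    calc (L : ℝ) * (1 - Real.cos (π / L)) ≤ L * ((π / L) ^ 2 / 2) :=
          mul_le_mul_of_nonneg_left (by linarith) (by linarith)
      _ = π ^ 2 / (2 * L) := e
  have h2 : m * (1 - Real.cos (π / m)) ≤ π ^ 2 / (2 * L) := by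
    have hc : 1 - (π / m) ^ 2 / 2 ≤ Real.cos (π / m) := Real.one_sub_sq_div_two_le_cos
    have e : m * ((π / m) ^ 2 / 2) = π ^ 2 / (2 * m) := by field_simp
    calc m * (1 - Real.cos (π / m)) ≤ m * ((π / m) ^ 2 / 2) :=
          mul_le_mul_of_nonneg_left (by linarith) (by linarith)
      _ = π ^ 2 / (2 * m) := e
      _ ≤ π ^ 2 / (2 * L) := div_le_div_of_nonneg_left (by positivity) (by positivity) (by linarith)
  have e3 : π ^ 2 / (2 * (L : ℝ)) + π ^ 2 / (2 * L) = π ^ 2 / L := by field_simp; ring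
  linarith [h1, h2, e3]

/-- The line kernel's tunnelling probability is `insProb` of the slice twist. [folklore] -/
theorem lineInsertion_real_eq (β : ℝ) :
    ((wilsonMeasure (d := 2) (L := L) u1Rep β) ⊗ₘ lineInsertionMH (L := L) β).real
        {q | topCharge (0 : Site 2 L) 0 1 q.1 ≠ topCharge (0 : Site 2 L) 0 1 q.2} =
      (insProb β (sliceTwist L) (0 : Site 2 L) 0 1).toReal := rfl

/-- **THE FIXED-VOLUME SHARP RATE OF THE LINE KERNEL** (`5 ≤ L`, every parity): for every `ε > 0`,
eventually in `β`, `e^{−β(E*_line + ε)} ≤ (μ_β ⊗ K_line){Q ≠ Q'} ≤ e^{−β(E*_line − ε)}` with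
`E*_line = L(1 − cos(π/L)) + (L² − L)(1 − cos(π/(L² − L)))`. [folklore] -/
theorem u1_lineInsertion_fixedVolume_rate (hL : 5 ≤ L) {ε : ℝ} (hε : 0 < ε) :
    ∀ᶠ β : ℝ in atTop,
      Real.exp (-(β * ((L : ℝ) * (1 - Real.cos (π / L)) +
          ((L : ℝ) ^ 2 - L) * (1 - Real.cos (π / ((L : ℝ) ^ 2 - L))) + ε))) ≤
        ((wilsonMeasure (d := 2) (L := L) u1Rep β) ⊗ₘ lineInsertionMH (L := L) β).real
          {q | topCharge (0 : Site 2 L) 0 1 q.1 ≠ topCharge (0 : Site 2 L) 0 1 q.2} ∧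
      ((wilsonMeasure (d := 2) (L := L) u1Rep β) ⊗ₘ lineInsertionMH (L := L) β).real
          {q | topCharge (0 : Site 2 L) 0 1 q.1 ≠ topCharge (0 : Site 2 L) 0 1 q.2} ≤
        Real.exp (-(β * ((L : ℝ) * (1 - Real.cos (π / L)) +
          ((L : ℝ) ^ 2 - L) * (1 - Real.cos (π / ((L : ℝ) ^ 2 - L))) - ε))) := by
  simp only [lineInsertion_real_eq, ← lineHeight_eq_sharp hL]
  exact insertion_height_law (sliceTwist L) (0 : Site 2 L) 0 1 (lineHeight_ne_top hL) hε

end LineValue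

end Summit.Ventures.LatticeQCDFlow.Theory2.Lattice.Flux

end
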